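import Summits.KontsevichZagierPeriods.KontsevichZagierPeriods.Theorems.SoloInformedEquidimStability
import Summits.KontsevichZagierPeriods.KontsevichZagierPeriods.Theorems.SoloInformedFlattening
import HarnessLib
import HarnessLib.Audit

/-!
# SoloInformed — total flattening and the flat-stabilisation theorem (Newton–Leibniz elimination, file 1b-C)

Solo programme `solo-KontsevichZagierPeriods-informed`, session s245 (K-NF file 1b-C of the
kernel programme of THEOREM NF, `paper/nl-elimination.md` §7).

With `relations₁₂ = soloInformedEquidimRelations` (moves (1a), (1b), (2)), the flattening operator
`Fl c = c * [[0,1]]`, the flattening span `U = image (Fl − id)` and the dimension grading `π_d` of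
files 583 / 1b-A / 1b-B, define the **total flattening to degree `N`**,
`Φ_N = Σ_{d ≤ N} Fl^{N−d} ∘ π_d` (recursively: `Φ₀ = π₀`, `Φ_{N+1} = Fl ∘ Φ_N + π_{N+1}`).
Main results (all unconditional unless `SoloInformedNLElimination` is named):

* `soloInformed_totalFlat_flatMap : Φ_N (Fl y) = Φ_N y − π_N y`, `Φ_N` preserves `relations₁₂`,
  `π_N ∘ Φ_N = Φ_N`, `Φ_{n+k} x = Fl^k x` for `x` homogeneous of degree `n`,
  `Φ_N x − x ∈ U` for `N ≫ 0`;
* **the flat-stabilisation (torsion) theorem** `soloInformed_mem_sup_iff_totalFlat`: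
  `x ∈ relations₁₂ ⊔ U ↔ ∃ M, ∀ N ≥ M, Φ_N x ∈ relations₁₂` — the quotient
  `FormalRep ⧸ (relations₁₂ ⊔ U)` is the direct limit of the equidimensional quotients
  `F_N ⧸ (relations₁₂)_N` along `Fl`; homogeneous form
  `soloInformed_mem_sup_iff_exists_flatPow : π_n x = x → (x ∈ relations₁₂ ⊔ U ↔ ∃ k, Fl^k x ∈ relations₁₂)`;
  and for a Newton–Leibniz-shaped pair `soloInformed_of_sub_of_mem_sup_iff_exists_flatIter_succ :
  [r] − [r'] ∈ relations₁₂ ⊔ U ↔ ∃ k, [flatIter r k] − [flatIter r' (k+1)] ∈ relations₁₂`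
  (`dim r = dim r' + 1`);
* **THEOREM NF in kernel form, as an equivalence** `soloInformed_nlElimination_iff_flatIter`:
  `SoloInformedNLElimination ↔` every Newton–Leibniz move `[band, f] − [base, F(b) − F(a)]`
  becomes an equidimensional relation after flattening both sides to a common dimension and `k`
  more times;
* **COROLLARY NF.1 (kernel form)** `soloInformed_equivalent_iff_exists_flatIter_of_nlElimination`:
  granting `SoloInformedNLElimination`, two representations of the same dimension are KZ-equivalent
  iff `[r × [0,1]^k] − [r' × [0,1]^k] ∈ relations₁₂` for some `k`; the reduction of different
  dimensions to equal ones, `soloInformed_equivalent_flatIter_iff`, is unconditional.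

References: M. Kontsevich, D. Zagier, *Periods* (2001), §1.2; this work (THEOREM NF,
COROLLARY NF.1, `paper/nl-elimination.md` §§2–3, 7).
-/

noncomputable section

open scoped BigOperators

namespace Summit.KontsevichZagierPeriods.KontsevichZagierPeriods.Theorems

open Set MeasureTheory
open Literature.ModelTheory.ExponentialFields
open Literature.NumberTheory.Transcendental Literature.NumberTheory.Transcendental.KZ

variable {n m k d : ℕ}

/-! ### `Fl` preserves `relations₁₂` -/

/-- `Fl` preserves `relations₁₂` (a right ideal, file 1b-A). [this work, THEOREM NF] -/
theorem soloInformed_flatMap_mem_equidimRelations {c : FormalRep}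
    (hc : c ∈ soloInformedEquidimRelations) :
    soloInformedFlatMap c ∈ soloInformedEquidimRelations := by
  rw [soloInformed_flatMap_apply]
  exact soloInformed_mul_mem_equidimRelations_right _ hc

/-- `Fl^k` preserves `relations₁₂`. [this work] -/
theorem soloInformed_flatPow_mem_equidimRelations (k : ℕ) {c : FormalRep}
    (hc : c ∈ soloInformedEquidimRelations) :
    soloInformedFlatPow k c ∈ soloInformedEquidimRelations := by
  induction k with
  | zero => exact hc
  | succ k ih =>
    rw [soloInformed_flatPow_succ_apply]; exact soloInformed_flatMap_mem_equidimRelations ih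

/-- `Fl^(k+1) c = Fl^k (Fl c)`. [this work] -/
theorem soloInformed_flatPow_succ_apply' (k : ℕ) (c : FormalRep) :
    soloInformedFlatPow (k + 1) c = soloInformedFlatPow k (soloInformedFlatMap c) := by
  induction k with
  | zero => rfl
  | succ k ih => rw [soloInformed_flatPow_succ_apply, ih, ← soloInformed_flatPow_succ_apply]

/-! ### Total flattening to degree `N` -/

/-- **Total flattening to degree `N`**, `Φ_N = Σ_{d ≤ N} Fl^{N−d} ∘ π_d : FormalRep →+ FormalRep`,
defined by `Φ₀ = π₀`, `Φ_{N+1} = Fl ∘ Φ_N + π_{N+1}`. [this work, THEOREM NF] -/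
def soloInformedTotalFlat : ℕ → (FormalRep →+ FormalRep)
  | 0 => soloInformedDimProj 0
  | N + 1 => soloInformedFlatMap.comp (soloInformedTotalFlat N) + soloInformedDimProj (N + 1)

/-- `Φ₀ c = π₀ c`. [this work] -/
theorem soloInformed_totalFlat_zero_apply (c : FormalRep) :
    soloInformedTotalFlat 0 c = soloInformedDimProj 0 c := rfl

/-- `Φ_{N+1} c = Fl (Φ_N c) + π_{N+1} c`. [this work] -/
theorem soloInformed_totalFlat_succ_apply (N : ℕ) (c : FormalRep) :
    soloInformedTotalFlat (N + 1) c =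
      soloInformedFlatMap (soloInformedTotalFlat N c) + soloInformedDimProj (N + 1) c := rfl

/-- **`Φ_N` preserves `relations₁₂`.** [this work, THEOREM NF] -/
theorem soloInformed_totalFlat_mem_equidimRelations (N : ℕ) {c : FormalRep}
    (hc : c ∈ soloInformedEquidimRelations) :
    soloInformedTotalFlat N c ∈ soloInformedEquidimRelations := by
  induction N with
  | zero => exact soloInformed_dimProj_mem_equidimRelations 0 hc
  | succ N ih =>
    rw [soloInformed_totalFlat_succ_apply]
    exact soloInformedEquidimRelations.add_mem (soloInformed_flatMap_mem_equidimRelations ih)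
      (soloInformed_dimProj_mem_equidimRelations (N + 1) hc)

/-- **`Φ_N (Fl y) = Φ_N y − π_N y`**: total flattening absorbs one flattening up to the top-degree
component. [this work, THEOREM NF] -/
theorem soloInformed_totalFlat_flatMap (N : ℕ) (y : FormalRep) :
    soloInformedTotalFlat N (soloInformedFlatMap y) =
      soloInformedTotalFlat N y - soloInformedDimProj N y := by
  induction N with
  | zero =>
    rw [soloInformed_totalFlat_zero_apply, soloInformed_totalFlat_zero_apply,
      soloInformed_dimProj_zero_flatMap, sub_self]
  | succ N ih =>
    rw [soloInformed_totalFlat_succ_apply N (soloInformedFlatMap y),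
      soloInformed_totalFlat_succ_apply N y, ih, map_sub, soloInformed_dimProj_succ_flatMap]
    abel

/-- `Φ_N x` is homogeneous of degree `N`: `π_N (Φ_N x) = Φ_N x`. [this work] -/
theorem soloInformed_dimProj_totalFlat (N : ℕ) (x : FormalRep) :
    soloInformedDimProj N (soloInformedTotalFlat N x) = soloInformedTotalFlat N x := by
  induction N with
  | zero => exact soloInformed_dimProj_dimProj_self 0 x
  | succ N ih =>
    rw [soloInformed_totalFlat_succ_apply, map_add, soloInformed_dimProj_succ_flatMap, ih,
      soloInformed_dimProj_dimProj_self]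

/-- `Φ_N x = 0` for `x` homogeneous of degree `n > N`. [this work] -/
theorem soloInformed_totalFlat_eq_zero_of_lt {x : FormalRep} (hx : soloInformedDimProj n x = x)
    {N : ℕ} (h : N < n) : soloInformedTotalFlat N x = 0 := by
  induction N with
  | zero =>
    rw [soloInformed_totalFlat_zero_apply, ← hx]
    exact soloInformed_dimProj_dimProj_of_ne (by omega) x
  | succ N ih =>
    rw [soloInformed_totalFlat_succ_apply, ih (by omega), map_zero, zero_add, ← hx]
    exact soloInformed_dimProj_dimProj_of_ne (by omega) x

/-- **`Φ_{n+k} x = Fl^k x` for `x` homogeneous of degree `n`.** [this work, THEOREM NF] -/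
theorem soloInformed_totalFlat_eq_flatPow {x : FormalRep} (hx : soloInformedDimProj n x = x)
    (k : ℕ) : soloInformedTotalFlat (n + k) x = soloInformedFlatPow k x := by
  induction k with
  | zero =>
    show soloInformedTotalFlat n x = x
    cases n with
    | zero => rw [soloInformed_totalFlat_zero_apply, hx]
    | succ m =>
      rw [soloInformed_totalFlat_succ_apply,
        soloInformed_totalFlat_eq_zero_of_lt hx (Nat.lt_succ_self m), map_zero, zero_add, hx]
  | succ k ih =>
    show soloInformedTotalFlat (n + k + 1) x = soloInformedFlatPow (k + 1) x
    have hπ : soloInformedDimProj (n + k + 1) x = 0 := by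
      rw [← hx]; exact soloInformed_dimProj_dimProj_of_ne (by omega) x
    rw [soloInformed_totalFlat_succ_apply, ih, hπ, add_zero, soloInformed_flatPow_succ_apply]

/-- `Φ_{n+k} [r] = [r × [0,1]^k]` for `r` of dimension `n`. [this work] -/
theorem soloInformed_totalFlat_of (r : IntegralRep n) (k : ℕ) :
    soloInformedTotalFlat (n + k) (of r) = of (soloInformedFlatIter r k) := by
  rw [soloInformed_totalFlat_eq_flatPow (soloInformed_dimProj_of_self r), soloInformed_flatPow_of]

/-- Every formal combination has bounded degree: `π_N y = 0` for `N ≫ 0`. [this work] -/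
theorem soloInformed_exists_dimProj_eq_zero (y : FormalRep) :
    ∃ M, ∀ N, M ≤ N → soloInformedDimProj N y = 0 := by
  induction y using FreeAbelianGroup.induction_on with
  | zero => exact ⟨0, fun N _ => map_zero _⟩
  | of x =>
    obtain ⟨n, r⟩ := x
    exact ⟨n + 1, fun N hN => soloInformed_dimProj_of_ne (by omega) r⟩
  | neg x ih =>
    obtain ⟨M, hM⟩ := ih
    exact ⟨M, fun N hN => by rw [map_neg, hM N hN, neg_zero]⟩
  | add x y hx hy =>
    obtain ⟨M₁, h₁⟩ := hx
    obtain ⟨M₂, h₂⟩ := hy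
    exact ⟨max M₁ M₂, fun N hN => by
      rw [map_add, h₁ N (le_of_max_le_left hN), h₂ N (le_of_max_le_right hN), add_zero]⟩

/-- **`Φ_N x − x ∈ U` for `N ≫ 0`**: every class modulo `U` (a fortiori modulo `relations`) has a
homogeneous representative in every large degree. [this work, THEOREM NF / COROLLARY NF.1] -/
theorem soloInformed_exists_totalFlat_sub_self_mem_flatSpan (x : FormalRep) :
    ∃ M, ∀ N, M ≤ N → soloInformedTotalFlat N x - x ∈ soloInformedFlatSpan := by
  induction x using FreeAbelianGroup.induction_on with
  | zero => exact ⟨0, fun N _ => by rw [map_zero, sub_zero]; exact soloInformedFlatSpan.zero_mem⟩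
  | of x =>
    obtain ⟨n, r⟩ := x
    refine ⟨n, fun N hN => ?_⟩
    obtain ⟨k, rfl⟩ := Nat.exists_eq_add_of_le hN
    change soloInformedTotalFlat (n + k) (of r) - of r ∈ soloInformedFlatSpan
    rw [soloInformed_totalFlat_eq_flatPow (soloInformed_dimProj_of_self r) k]
    exact soloInformed_flatPow_sub_self_mem_flatSpan k (of r)
  | neg x ih =>
    obtain ⟨M, hM⟩ := ih
    refine ⟨M, fun N hN => ?_⟩
    have h : soloInformedTotalFlat N (-FreeAbelianGroup.of x) - -FreeAbelianGroup.of x =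
        -(soloInformedTotalFlat N (FreeAbelianGroup.of x) - FreeAbelianGroup.of x) := by
      rw [map_neg]; abel
    rw [h]; exact soloInformedFlatSpan.neg_mem (hM N hN)
  | add x y hx hy =>
    obtain ⟨M₁, h₁⟩ := hx
    obtain ⟨M₂, h₂⟩ := hy
    refine ⟨max M₁ M₂, fun N hN => ?_⟩
    have h : soloInformedTotalFlat N (x + y) - (x + y) =
        (soloInformedTotalFlat N x - x) + (soloInformedTotalFlat N y - y) := by
      rw [map_add]; abel
    rw [h]
    exact soloInformedFlatSpan.add_mem (h₁ N (le_of_max_le_left hN)) (h₂ N (le_of_max_le_right hN))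

/-- `Φ_N x − x ∈ relations` for `N ≫ 0`. [this work] -/
theorem soloInformed_exists_totalFlat_sub_self_mem_relations (x : FormalRep) :
    ∃ M, ∀ N, M ≤ N → soloInformedTotalFlat N x - x ∈ relations := by
  obtain ⟨M, hM⟩ := soloInformed_exists_totalFlat_sub_self_mem_flatSpan x
  exact ⟨M, fun N hN => soloInformed_flatSpan_le_relations (hM N hN)⟩

/-! ### The flat-stabilisation (torsion) theorem -/

/-- **Flat-stabilisation theorem.** `x ∈ relations₁₂ ⊔ U ↔ Φ_N x ∈ relations₁₂` for all large `N`: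
modulo the flattening span, a combination is an equidimensional relation iff its total flattening
to high degree is.  (`⟹`: `x = ρ + (Fl y − y)` and `Φ_N (Fl y − y) = −π_N y = 0` for `N > deg y`;
`⟸`: `x = Φ_N x − (Φ_N x − x)`.) [this work, THEOREM NF] -/
theorem soloInformed_mem_sup_iff_totalFlat (x : FormalRep) :
    x ∈ soloInformedEquidimRelations ⊔ soloInformedFlatSpan ↔
      ∃ M, ∀ N, M ≤ N → soloInformedTotalFlat N x ∈ soloInformedEquidimRelations := by
  constructor
  · intro hx
    obtain ⟨ρ, hρ, u, hu, rfl⟩ := AddSubgroup.mem_sup.mp hx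
    obtain ⟨y, rfl⟩ := (soloInformed_mem_flatSpan_iff u).mp hu
    obtain ⟨M, hM⟩ := soloInformed_exists_dimProj_eq_zero y
    refine ⟨M, fun N hN => ?_⟩
    rw [map_add, map_sub, soloInformed_totalFlat_flatMap, hM N hN, sub_zero, sub_self, add_zero]
    exact soloInformed_totalFlat_mem_equidimRelations N hρ
  · rintro ⟨M, hM⟩
    obtain ⟨M', hM'⟩ := soloInformed_exists_totalFlat_sub_self_mem_flatSpan x
    have h := (soloInformedEquidimRelations ⊔ soloInformedFlatSpan).sub_mem
      (AddSubgroup.mem_sup_left (hM (max M M') (le_max_left _ _)))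
      (AddSubgroup.mem_sup_right (hM' (max M M') (le_max_right _ _)))
    rwa [sub_sub_cancel] at h

/-- **Flat-stabilisation, homogeneous form.** For `x` homogeneous of degree `n`:
`x ∈ relations₁₂ ⊔ U ↔ ∃ k, Fl^k x ∈ relations₁₂`. [this work, THEOREM NF] -/
theorem soloInformed_mem_sup_iff_exists_flatPow {x : FormalRep}
    (hx : soloInformedDimProj n x = x) :
    x ∈ soloInformedEquidimRelations ⊔ soloInformedFlatSpan ↔
      ∃ k, soloInformedFlatPow k x ∈ soloInformedEquidimRelations := by
  constructor
  · intro h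
    obtain ⟨M, hM⟩ := (soloInformed_mem_sup_iff_totalFlat x).mp h
    refine ⟨M, ?_⟩
    rw [← soloInformed_totalFlat_eq_flatPow hx M]
    exact hM (n + M) (Nat.le_add_left M n)
  · rintro ⟨k, hk⟩
    exact soloInformed_mem_sup_of_flatPow_mem k hk

/-- **Flat-stabilisation for a pair of equal dimension**:
`[r] − [r'] ∈ relations₁₂ ⊔ U ↔ ∃ k, [r × [0,1]^k] − [r' × [0,1]^k] ∈ relations₁₂`.
[this work, COROLLARY NF.1] -/
theorem soloInformed_of_sub_of_mem_sup_iff_exists_flatIter (r r' : IntegralRep n) :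
    of r - of r' ∈ soloInformedEquidimRelations ⊔ soloInformedFlatSpan ↔
      ∃ k, of (soloInformedFlatIter r k) - of (soloInformedFlatIter r' k) ∈
        soloInformedEquidimRelations := by
  rw [soloInformed_mem_sup_iff_exists_flatPow (x := of r - of r') (n := n)
    (by rw [map_sub, soloInformed_dimProj_of_self, soloInformed_dimProj_of_self])]
  simp only [map_sub, soloInformed_flatPow_of]

/-- **Flat-stabilisation for a Newton–Leibniz-shaped pair** (`dim r = dim r' + 1`):
`[r] − [r'] ∈ relations₁₂ ⊔ U ↔ ∃ k, [r × [0,1]^k] − [r' × [0,1]^(k+1)] ∈ relations₁₂`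
(`[r] − [r'] = ([r] − Fl [r']) + (Fl [r'] − [r'])`, the first summand homogeneous of degree
`dim r`, the second in `U`). [this work, THEOREM NF] -/
theorem soloInformed_of_sub_of_mem_sup_iff_exists_flatIter_succ (r : IntegralRep (n + 1))
    (r' : IntegralRep n) :
    of r - of r' ∈ soloInformedEquidimRelations ⊔ soloInformedFlatSpan ↔
      ∃ k, of (soloInformedFlatIter r k) - of (soloInformedFlatIter r' (k + 1)) ∈
        soloInformedEquidimRelations := by
  have hsplit : of r - of r' =
      (of r - soloInformedFlatMap (of r')) + (soloInformedFlatMap (of r') - of r') := by abel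
  have hhom : soloInformedDimProj (n + 1) (of r - soloInformedFlatMap (of r')) =
      of r - soloInformedFlatMap (of r') := by
    rw [map_sub, soloInformed_dimProj_of_self, soloInformed_dimProj_succ_flatMap,
      soloInformed_dimProj_of_self]
  have hpow : ∀ k, soloInformedFlatPow k (of r - soloInformedFlatMap (of r')) =
      of (soloInformedFlatIter r k) - of (soloInformedFlatIter r' (k + 1)) := by
    intro k
    rw [map_sub, soloInformed_flatPow_of, ← soloInformed_flatPow_succ_apply',
      soloInformed_flatPow_of]
  have hU : soloInformedFlatMap (of r') - of r' ∈
      soloInformedEquidimRelations ⊔ soloInformedFlatSpan :=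
    AddSubgroup.mem_sup_right (soloInformed_flatMap_sub_self_mem_flatSpan (of r'))
  constructor
  · intro h
    have h' := (soloInformedEquidimRelations ⊔ soloInformedFlatSpan).sub_mem h hU
    rw [hsplit, add_sub_cancel_right] at h'
    obtain ⟨k, hk⟩ := (soloInformed_mem_sup_iff_exists_flatPow hhom).mp h'
    exact ⟨k, by rwa [hpow] at hk⟩
  · rintro ⟨k, hk⟩
    rw [hsplit]
    refine (soloInformedEquidimRelations ⊔ soloInformedFlatSpan).add_mem ?_ hU
    rw [← hpow] at hk
    exact soloInformed_mem_sup_of_flatPow_mem k hk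

/-! ### THEOREM NF as an equivalence, and COROLLARY NF.1 -/

/-- **THEOREM NF ⟺ flat-stability of the Newton–Leibniz rule** (form with `Φ_N`):
`SoloInformedNLElimination ↔ ∀ c ∈ newtonLeibnizRel, Φ_N c ∈ relations₁₂` for all large `N`.
[this work, THEOREM NF] -/
theorem soloInformed_nlElimination_iff_totalFlat :
    SoloInformedNLElimination ↔ ∀ c ∈ newtonLeibnizRel,
      ∃ M, ∀ N, M ≤ N → soloInformedTotalFlat N c ∈ soloInformedEquidimRelations :=
  ⟨fun h c hc => (soloInformed_mem_sup_iff_totalFlat c).mp (h hc),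
    fun h c hc => (soloInformed_mem_sup_iff_totalFlat c).mpr (h c hc)⟩

/-- **THEOREM NF ⟺ flat-stability of the Newton–Leibniz rule** (form with iterated flattening):
`SoloInformedNLElimination` holds iff every Newton–Leibniz move `[band, f] − [base, F(b) − F(a)]`
becomes an equidimensional relation (a `ℤ`-combination of moves (1a), (1b), (2)) after flattening
both sides to a common dimension and `k` further times:
`[band × [0,1]^k] − [base × [0,1]^(k+1)] ∈ relations₁₂`. [this work, THEOREM NF] -/
theorem soloInformed_nlElimination_iff_flatIter :
    SoloInformedNLElimination ↔ ∀ (n : ℕ) (r : IntegralRep (n + 1)) (r' : IntegralRep n),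
      of r - of r' ∈ newtonLeibnizRel → ∃ k,
        of (soloInformedFlatIter r k) - of (soloInformedFlatIter r' (k + 1)) ∈
          soloInformedEquidimRelations := by
  constructor
  · intro h n r r' hc
    exact (soloInformed_of_sub_of_mem_sup_iff_exists_flatIter_succ r r').mp (h hc)
  · intro h c hc
    obtain ⟨n, r, r', a, b, F, hF, ha, hb, hab, hdom, hcont, hderiv, hr', rfl⟩ := hc
    exact (soloInformed_of_sub_of_mem_sup_iff_exists_flatIter_succ r r').mpr
      (h n r r' ⟨n, r, r', a, b, F, hF, ha, hb, hab, hdom, hcont, hderiv, hr', rfl⟩)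

/-- Granting `SoloInformedNLElimination`, **every KZ relation flat-stabilises into `relations₁₂`**:
`x ∈ relations ↔ Φ_N x ∈ relations₁₂` for all large `N`. [this work, THEOREM NF] -/
theorem soloInformed_mem_relations_iff_totalFlat_of_nlElimination (h : SoloInformedNLElimination)
    (x : FormalRep) :
    x ∈ relations ↔ ∃ M, ∀ N, M ≤ N → soloInformedTotalFlat N x ∈ soloInformedEquidimRelations := by
  rw [soloInformed_relations_eq_sup_of_nlElimination h]
  exact soloInformed_mem_sup_iff_totalFlat x

/-- **Reduction to equal dimensions** (unconditional): `r × [0,1]^j ∼ r' × [0,1]^k ↔ r ∼ r'`.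
[this work, COROLLARY NF.1] -/
theorem soloInformed_equivalent_flatIter_iff (r : IntegralRep n) (r' : IntegralRep m) (j k : ℕ) :
    Equivalent (soloInformedFlatIter r j) (soloInformedFlatIter r' k) ↔ Equivalent r r' := by
  have hj : of (soloInformedFlatIter r j) - of r ∈ relations := soloInformed_equivalent_flatIter r j
  have hk : of (soloInformedFlatIter r' k) - of r' ∈ relations :=
    soloInformed_equivalent_flatIter r' k
  have hsplit : of (soloInformedFlatIter r j) - of (soloInformedFlatIter r' k) =
      (of (soloInformedFlatIter r j) - of r) + (of r - of r') -
        (of (soloInformedFlatIter r' k) - of r') := by abel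
  unfold Equivalent
  constructor
  · intro h
    have h' : of r - of r' = (of (soloInformedFlatIter r j) - of (soloInformedFlatIter r' k)) -
        (of (soloInformedFlatIter r j) - of r) + (of (soloInformedFlatIter r' k) - of r') := by abel
    rw [h']
    exact relations.add_mem (relations.sub_mem h hj) hk
  · intro h
    rw [hsplit]
    exact relations.sub_mem (relations.add_mem hj h) hk

/-- **COROLLARY NF.1 (kernel form).** Granting `SoloInformedNLElimination`, two representations of
the same dimension are KZ-equivalent iff they become equivalent under the equidimensional rules
(1a), (1b), (2) alone after the same number of flattenings:
`r ∼ r' ↔ ∃ k, [r × [0,1]^k] − [r' × [0,1]^k] ∈ relations₁₂`.  (Different dimensions reduce to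
this by `soloInformed_equivalent_flatIter_iff`; the direction `⟸` is unconditional,
`soloInformed_equivalent_of_flatIter_sub_mem`.) [this work, COROLLARY NF.1] -/
theorem soloInformed_equivalent_iff_exists_flatIter_of_nlElimination (h : SoloInformedNLElimination)
    (r r' : IntegralRep n) :
    Equivalent r r' ↔ ∃ k, of (soloInformedFlatIter r k) - of (soloInformedFlatIter r' k) ∈
      soloInformedEquidimRelations := by
  rw [soloInformed_equivalent_iff_of_nlElimination h]
  exact soloInformed_of_sub_of_mem_sup_iff_exists_flatIter r r'

end Summit.KontsevichZagierPeriods.KontsevichZagierPeriods.Theorems
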